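import Summits.HubbardSuperconductivity.HubbardSuperconductivity.Theorems.AnisotropyChordTransferFibre3FinXDTables

/-!
# Route `AnisotropyChord` / H0 rotor rung: FIN per-`L` row-D evaluator XD — soundness layer 1b: the point sums

Soundness of the exact point sums of `…Fibre3FinXDEval` (prover seat `hubbard-h0-rotor-p3` g7):
* ★ `sumT_lower/upper`, `sumG3_lower/upper`: the point sums at `la` (resp. `lb`) bound `D²·Σ g g`, `D³·Σ g g g` (natural-coordinate
  forms `natT`, `natG3`) from below (resp. above) for EVERY `λ` of the cell (`g ≥ 0` increasing in `λ`: XB2's `gPt_lo/gPt_hi`);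
* ★ `sumW_mem`: the signed cos/sin accumulation encloses `D³·(Re W, Im W)` (natural forms `natWre/natWim` over the reflected row sums
  `rowR`) AT the cell's lower end `λ₀ = la/D` (degenerate cell `[la, la]`).
Helper for piece A = stmt-HubbardSuperconductivity-23918 of rung 19089 (`--supports`, helper class).  WHAT THIS IS NOT: nothing here
proves superconductivity in the Hubbard model (rotor TARGET as worded stays FALSE, g15 verdict); evaluator soundness for the FIN
certificates of ONE conditional reduction.  Tree imports only; no sorry, no new axioms.
-/

set_option linter.dupNamespace false
set_option autoImplicit false

namespace Summit.HubbardSuperconductivity.HubbardSuperconductivity.Theorems.AnisotropyChord.Transfer.Fibre3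

namespace FinXD

open scoped BigOperators
open Finset Hole2 FinCell FinXB

/-! ## The point sums bound the lattice sums on the cell -/

section cell

variable {L : ℕ} [NeZero L] {lam : ℝ} {la lb : ℤ}

/-- one row of the `T`-sum: lower bound at `la`. [folklore] -/
theorem rowT_lower (hL : 3 ≤ L) (hla : (la : ℝ) ≤ lam * ((D : ℤ) : ℝ)) (hlb : lam * ((D : ℤ) : ℝ) ≤ (lb : ℝ))
    (hpos : denCellPos L (cosTab L) la lb = true) (hna : gPtNonneg L la = true)
    {p1 s : ℕ} (q2 : ℕ) (hp1 : p1 < L) (hs : s < L) :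
    (((dotP ((gPt L la).getD p1 []) (((gPt L la).getD s []).rotate q2) (0, 0)).1 : ℤ) : ℝ)
      ≤ (∑ p2 ∈ range L, xg (L := L) lam p1 p2 * xg (L := L) lam s ((p2 + q2) % L)) * ((D : ℤ) : ℝ) * ((D : ℤ) : ℝ) := by
  have hL0 : 0 < L := by omega
  rw [gPt_row L la hp1, gPt_row L la hs]
  have hl1 : ((List.range L).map (gAt (gresCellTab L (cosTab L) la la) p1)).length = L := by simp
  have hl2 : (((List.range L).map (gAt (gresCellTab L (cosTab L) la la) s)).rotate q2).length = L := by simp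
  have h := dotP_lower ((List.range L).map (gAt (gresCellTab L (cosTab L) la la) p1))
    (((List.range L).map (gAt (gresCellTab L (cosTab L) la la) s)).rotate q2)
    (fun p2 => xg (L := L) lam p1 p2) (fun p2 => xg (L := L) lam s ((p2 + q2) % L)) (0, 0) (by rw [hl1, hl2])
    (fun j hj => by
      rw [hl1] at hj
      rw [getIv_map_range _ hj]
      exact gPt_lo hL hla hlb hpos hna hp1 hj)
    (fun j hj => by
      rw [hl2] at hj
      rw [getIv_rotate L _ q2 hj]
      exact gPt_lo hL hla hlb hpos hna hs (Nat.mod_lt _ hL0))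
  rw [hl1] at h
  simpa using h

/-- one row of the `T`-sum: upper bound at `lb`. [folklore] -/
theorem rowT_upper (hL : 3 ≤ L) (hla : (la : ℝ) ≤ lam * ((D : ℤ) : ℝ)) (hlb : lam * ((D : ℤ) : ℝ) ≤ (lb : ℝ))
    (hpos : denCellPos L (cosTab L) la lb = true) (hna : gPtNonneg L la = true)
    {p1 s : ℕ} (q2 : ℕ) (hp1 : p1 < L) (hs : s < L) :
    (∑ p2 ∈ range L, xg (L := L) lam p1 p2 * xg (L := L) lam s ((p2 + q2) % L)) * ((D : ℤ) : ℝ) * ((D : ℤ) : ℝ)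
      ≤ (((dotP ((gPt L lb).getD p1 []) (((gPt L lb).getD s []).rotate q2) (0, 0)).2 : ℤ) : ℝ) := by
  have hL0 : 0 < L := by omega
  rw [gPt_row L lb hp1, gPt_row L lb hs]
  have hl1 : ((List.range L).map (gAt (gresCellTab L (cosTab L) lb lb) p1)).length = L := by simp
  have hl2 : (((List.range L).map (gAt (gresCellTab L (cosTab L) lb lb) s)).rotate q2).length = L := by simp
  have h := dotP_upper ((List.range L).map (gAt (gresCellTab L (cosTab L) lb lb) p1))
    (((List.range L).map (gAt (gresCellTab L (cosTab L) lb lb) s)).rotate q2)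
    (fun p2 => xg (L := L) lam p1 p2) (fun p2 => xg (L := L) lam s ((p2 + q2) % L)) (0, 0) (by rw [hl1, hl2])
    (fun j hj => by
      rw [hl1] at hj
      rw [getIv_map_range _ hj]
      exact gPt_hi hL hla hlb hpos hna hp1 hj)
    (fun j hj => by
      rw [hl2] at hj
      rw [getIv_rotate L _ q2 hj]
      exact gPt_hi hL hla hlb hpos hna hs (Nat.mod_lt _ hL0))
  rw [hl1] at h
  simpa using h

/-- the natural-coordinate double sum behind `sumT`. -/
noncomputable def natT (L : ℕ) [NeZero L] (lam : ℝ) (q1 q2 : ℕ) : ℝ :=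
  ∑ p1 ∈ range L, ∑ p2 ∈ range L, xg (L := L) lam p1 p2 * xg (L := L) lam ((p1 + q1) % L) ((p2 + q2) % L)

/-- ★ `sumT` at `la` is below `D²·T` on the cell. [folklore] -/
theorem sumT_lower (hL : 3 ≤ L) (hla : (la : ℝ) ≤ lam * ((D : ℤ) : ℝ)) (hlb : lam * ((D : ℤ) : ℝ) ≤ (lb : ℝ))
    (hpos : denCellPos L (cosTab L) la lb = true) (hna : gPtNonneg L la = true)
    (q1 q2 : ℕ) :
    (((sumT L (gPt L la) q1 q2).1 : ℤ) : ℝ) ≤ natT L lam q1 q2 * ((D : ℤ) : ℝ) * ((D : ℤ) : ℝ) := by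
  have hL0 : 0 < L := by omega
  unfold sumT natT
  rw [psum_fst, Finset.sum_mul, Finset.sum_mul]
  push_cast
  refine Finset.sum_le_sum fun p1 hp1 => ?_
  rw [mem_range] at hp1
  exact rowT_lower hL hla hlb hpos hna q2 hp1 (Nat.mod_lt _ hL0)

/-- ★ `sumT` at `lb` is above `D²·T` on the cell. [folklore] -/
theorem sumT_upper (hL : 3 ≤ L) (hla : (la : ℝ) ≤ lam * ((D : ℤ) : ℝ)) (hlb : lam * ((D : ℤ) : ℝ) ≤ (lb : ℝ))
    (hpos : denCellPos L (cosTab L) la lb = true) (hna : gPtNonneg L la = true)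
    (q1 q2 : ℕ) :
    natT L lam q1 q2 * ((D : ℤ) : ℝ) * ((D : ℤ) : ℝ) ≤ (((sumT L (gPt L lb) q1 q2).2 : ℤ) : ℝ) := by
  have hL0 : 0 < L := by omega
  unfold sumT natT
  rw [psum_snd, Finset.sum_mul, Finset.sum_mul]
  push_cast
  refine Finset.sum_le_sum fun p1 hp1 => ?_
  rw [mem_range] at hp1
  exact rowT_upper hL hla hlb hpos hna q2 hp1 (Nat.mod_lt _ hL0)

/-- the natural-coordinate double sum behind `sumG3`. -/
noncomputable def natG3 (L : ℕ) [NeZero L] (lam : ℝ) (s1 s2 t1 t2 : ℕ) : ℝ :=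
  ∑ p1 ∈ range L, ∑ p2 ∈ range L,
    xg (L := L) lam p1 p2 * xg (L := L) lam ((p1 + s1) % L) ((p2 + s2) % L) * xg (L := L) lam ((p1 + t1) % L) ((p2 + t2) % L)

/-- ★ `sumG3` at `la` is below `D³·G₃` on the cell. [folklore] -/
theorem sumG3_lower (hL : 3 ≤ L) (hla : (la : ℝ) ≤ lam * ((D : ℤ) : ℝ)) (hlb : lam * ((D : ℤ) : ℝ) ≤ (lb : ℝ))
    (hpos : denCellPos L (cosTab L) la lb = true) (hna : gPtNonneg L la = true)
    (s1 s2 t1 t2 : ℕ) :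
    (((sumG3 L (gPt L la) s1 s2 t1 t2).1 : ℤ) : ℝ) ≤ natG3 L lam s1 s2 t1 t2 * ((D : ℤ) : ℝ) * ((D : ℤ) : ℝ) * ((D : ℤ) : ℝ) := by
  have hL0 : 0 < L := by omega
  unfold sumG3 natG3
  rw [psum_fst, Finset.sum_mul, Finset.sum_mul, Finset.sum_mul]
  push_cast
  refine Finset.sum_le_sum fun p1 hp1 => ?_
  rw [mem_range] at hp1
  have hs : (p1 + s1) % L < L := Nat.mod_lt _ hL0
  have ht : (p1 + t1) % L < L := Nat.mod_lt _ hL0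
  rw [gPt_row L la hp1, gPt_row L la hs, gPt_row L la ht]
  have hl1 : ((List.range L).map (gAt (gresCellTab L (cosTab L) la la) p1)).length = L := by simp
  have hl2 : (((List.range L).map (gAt (gresCellTab L (cosTab L) la la) ((p1 + s1) % L))).rotate s2).length = L := by simp
  have hl3 : (((List.range L).map (gAt (gresCellTab L (cosTab L) la la) ((p1 + t1) % L))).rotate t2).length = L := by simp
  have h := dotP3_lower ((List.range L).map (gAt (gresCellTab L (cosTab L) la la) p1))
    (((List.range L).map (gAt (gresCellTab L (cosTab L) la la) ((p1 + s1) % L))).rotate s2)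
    (((List.range L).map (gAt (gresCellTab L (cosTab L) la la) ((p1 + t1) % L))).rotate t2)
    (fun p2 => xg (L := L) lam p1 p2) (fun p2 => xg (L := L) lam ((p1 + s1) % L) ((p2 + s2) % L))
    (fun p2 => xg (L := L) lam ((p1 + t1) % L) ((p2 + t2) % L)) (0, 0) (by rw [hl1, hl2]) (by rw [hl1, hl3])
    (fun j hj => by
      rw [hl1] at hj
      rw [getIv_map_range _ hj]
      exact gPt_lo hL hla hlb hpos hna hp1 hj)
    (fun j hj => by
      rw [hl2] at hj
      rw [getIv_rotate L _ s2 hj]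
      exact gPt_lo hL hla hlb hpos hna hs (Nat.mod_lt _ hL0))
    (fun j hj => by
      rw [hl3] at hj
      rw [getIv_rotate L _ t2 hj]
      exact gPt_lo hL hla hlb hpos hna ht (Nat.mod_lt _ hL0))
  rw [hl1] at h
  simpa using h

/-- ★ `sumG3` at `lb` is above `D³·G₃` on the cell. [folklore] -/
theorem sumG3_upper (hL : 3 ≤ L) (hla : (la : ℝ) ≤ lam * ((D : ℤ) : ℝ)) (hlb : lam * ((D : ℤ) : ℝ) ≤ (lb : ℝ))
    (hpos : denCellPos L (cosTab L) la lb = true) (hna : gPtNonneg L la = true)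
    (s1 s2 t1 t2 : ℕ) :
    natG3 L lam s1 s2 t1 t2 * ((D : ℤ) : ℝ) * ((D : ℤ) : ℝ) * ((D : ℤ) : ℝ) ≤ (((sumG3 L (gPt L lb) s1 s2 t1 t2).2 : ℤ) : ℝ) := by
  have hL0 : 0 < L := by omega
  unfold sumG3 natG3
  rw [psum_snd, Finset.sum_mul, Finset.sum_mul, Finset.sum_mul]
  push_cast
  refine Finset.sum_le_sum fun p1 hp1 => ?_
  rw [mem_range] at hp1
  have hs : (p1 + s1) % L < L := Nat.mod_lt _ hL0
  have ht : (p1 + t1) % L < L := Nat.mod_lt _ hL0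
  rw [gPt_row L lb hp1, gPt_row L lb hs, gPt_row L lb ht]
  have hl1 : ((List.range L).map (gAt (gresCellTab L (cosTab L) lb lb) p1)).length = L := by simp
  have hl2 : (((List.range L).map (gAt (gresCellTab L (cosTab L) lb lb) ((p1 + s1) % L))).rotate s2).length = L := by simp
  have hl3 : (((List.range L).map (gAt (gresCellTab L (cosTab L) lb lb) ((p1 + t1) % L))).rotate t2).length = L := by simp
  have h := dotP3_upper ((List.range L).map (gAt (gresCellTab L (cosTab L) lb lb) p1))
    (((List.range L).map (gAt (gresCellTab L (cosTab L) lb lb) ((p1 + s1) % L))).rotate s2)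
    (((List.range L).map (gAt (gresCellTab L (cosTab L) lb lb) ((p1 + t1) % L))).rotate t2)
    (fun p2 => xg (L := L) lam p1 p2) (fun p2 => xg (L := L) lam ((p1 + s1) % L) ((p2 + s2) % L))
    (fun p2 => xg (L := L) lam ((p1 + t1) % L) ((p2 + t2) % L)) (0, 0) (by rw [hl1, hl2]) (by rw [hl1, hl3])
    (fun j hj => by
      rw [hl1] at hj
      rw [getIv_map_range _ hj]
      exact gPt_hi hL hla hlb hpos hna hp1 hj)
    (fun j hj => by
      rw [hl2] at hj
      rw [getIv_rotate L _ s2 hj]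
      exact gPt_hi hL hla hlb hpos hna hs (Nat.mod_lt _ hL0))
    (fun j hj => by
      rw [hl3] at hj
      rw [getIv_rotate L _ t2 hj]
      exact gPt_hi hL hla hlb hpos hna ht (Nat.mod_lt _ hL0))
  rw [hl1] at h
  simpa using h

/-! ## The twisted sum at the lower end of the cell -/

/-- the reflected row sum `Σ_{p₂} g(p₁,p₂) g((q₁−p₁) mod L, (q₂−p₂) mod L)`. -/
noncomputable def rowR (L : ℕ) [NeZero L] (lam : ℝ) (q1 q2 p1 : ℕ) : ℝ :=
  ∑ p2 ∈ range L, xg (L := L) lam p1 p2 * xg (L := L) lam ((q1 + L - p1) % L) ((q2 + L - p2) % L)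

/-- the natural-coordinate real and imaginary parts of `W(q)`: `Σ_{p₁} cos / sin (2πp₁/L) · rowR`. -/
noncomputable def natWre (L : ℕ) [NeZero L] (lam : ℝ) (q1 q2 : ℕ) : ℝ :=
  ∑ p1 ∈ range L, Real.cos (2 * Real.pi * p1 / L) * rowR L lam q1 q2 p1
/-- see `natWre`. -/
noncomputable def natWim (L : ℕ) [NeZero L] (lam : ℝ) (q1 q2 : ℕ) : ℝ :=
  ∑ p1 ∈ range L, Real.sin (2 * Real.pi * p1 / L) * rowR L lam q1 q2 p1

/-- the reflected row product at the POINT `λ₀·D = la` (degenerate cell `[la, la]`): two-sided, nonnegative. [folklore] -/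
theorem rowR_mem (hL : 3 ≤ L) (hla : (la : ℝ) ≤ lam * ((D : ℤ) : ℝ)) (hlb : lam * ((D : ℤ) : ℝ) ≤ (la : ℝ))
    (hpos : denCellPos L (cosTab L) la la = true) (hna : gPtNonneg L la = true)
    {q1 q2 p1 : ℕ} (hq2 : q2 < L) (hp1 : p1 < L) :
    let d := dotP ((gPt L la).getD p1 []) (rowRefl L ((gPt L la).getD ((q1 + L - p1 % L) % L) []) q2) (0, 0)
    0 ≤ ((d.1 : ℤ) : ℝ) ∧ ((d.1 : ℤ) : ℝ) ≤ rowR L lam q1 q2 p1 * ((D : ℤ) : ℝ) * ((D : ℤ) : ℝ) ∧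
      rowR L lam q1 q2 p1 * ((D : ℤ) : ℝ) * ((D : ℤ) : ℝ) ≤ ((d.2 : ℤ) : ℝ) := by
  intro d
  have hL0 : 0 < L := by omega
  have hs : (q1 + L - p1 % L) % L < L := Nat.mod_lt _ hL0
  have hpm : p1 % L = p1 := Nat.mod_eq_of_lt hp1
  have hl1 : ((List.range L).map (gAt (gresCellTab L (cosTab L) la la) p1)).length = L := by simp
  have hl2 : (rowRefl L ((List.range L).map (gAt (gresCellTab L (cosTab L) la la) ((q1 + L - p1 % L) % L))) q2).length = L := by
    rw [length_rowRefl]; simp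
  have hd : d = dotP ((List.range L).map (gAt (gresCellTab L (cosTab L) la la) p1))
      (rowRefl L ((List.range L).map (gAt (gresCellTab L (cosTab L) la la) ((q1 + L - p1 % L) % L))) q2) (0, 0) := by
    show dotP _ _ _ = _
    rw [gPt_row L la hp1, gPt_row L la hs]
  have hlow := dotP_lower ((List.range L).map (gAt (gresCellTab L (cosTab L) la la) p1))
    (rowRefl L ((List.range L).map (gAt (gresCellTab L (cosTab L) la la) ((q1 + L - p1 % L) % L))) q2)
    (fun p2 => xg (L := L) lam p1 p2) (fun p2 => xg (L := L) lam ((q1 + L - p1) % L) ((q2 + L - p2) % L))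
    (0, 0) (by rw [hl1, hl2])
    (fun j hj => by
      rw [hl1] at hj
      rw [getIv_map_range _ hj]
      exact gPt_lo hL hla hlb hpos hna hp1 hj)
    (fun j hj => by
      rw [hl2] at hj
      rw [getIv_rowRefl L _ hq2 hj, hpm]
      exact gPt_lo hL hla hlb hpos hna (by rw [← hpm]; exact hs) (Nat.mod_lt _ hL0))
  have hupp := dotP_upper ((List.range L).map (gAt (gresCellTab L (cosTab L) la la) p1))
    (rowRefl L ((List.range L).map (gAt (gresCellTab L (cosTab L) la la) ((q1 + L - p1 % L) % L))) q2)
    (fun p2 => xg (L := L) lam p1 p2) (fun p2 => xg (L := L) lam ((q1 + L - p1) % L) ((q2 + L - p2) % L))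
    (0, 0) (by rw [hl1, hl2])
    (fun j hj => by
      rw [hl1] at hj
      rw [getIv_map_range _ hj]
      exact gPt_hi hL hla hlb hpos hna hp1 hj)
    (fun j hj => by
      rw [hl2] at hj
      rw [getIv_rowRefl L _ hq2 hj, hpm]
      exact gPt_hi hL hla hlb hpos hna (by rw [← hpm]; exact hs) (Nat.mod_lt _ hL0))
  rw [hl1] at hlow hupp
  rw [hd]
  refine ⟨?_, ?_, ?_⟩
  · -- nonnegativity of the exact lower accumulation: every lower end is nonnegative
    have hrow : ∀ (l1 l2 : List Iv) (acc : ℤ × ℤ), (∀ j, j < l1.length → 0 ≤ (getIv l1 j).1) →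
        (∀ j, j < l2.length → 0 ≤ (getIv l2 j).1) → 0 ≤ acc.1 → 0 ≤ (dotP l1 l2 acc).1 := by
      intro l1
      induction l1 with
      | nil => intro l2 acc _ _ h0; cases l2 <;> simpa [dotP] using h0
      | cons a as ih =>
        intro l2 acc h1 h2 h0
        cases l2 with
        | nil => simpa [dotP] using h0
        | cons b bs =>
          simp only [dotP]
          have ha : 0 ≤ a.1 := by simpa [getIv] using h1 0 (by simp)
          have hb : 0 ≤ b.1 := by simpa [getIv] using h2 0 (by simp)
          exact ih bs _ (fun j hj => by simpa [getIv] using h1 (j + 1) (by simpa using hj))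
            (fun j hj => by simpa [getIv] using h2 (j + 1) (by simpa using hj)) (by positivity)
    have hz := hrow ((List.range L).map (gAt (gresCellTab L (cosTab L) la la) p1))
      (rowRefl L ((List.range L).map (gAt (gresCellTab L (cosTab L) la la) ((q1 + L - p1 % L) % L))) q2) (0, 0)
      (fun j hj => by
        rw [hl1] at hj
        rw [getIv_map_range _ hj]
        exact gPtNonneg_spec L hna hp1 hj)
      (fun j hj => by
        rw [hl2] at hj
        rw [getIv_rowRefl L _ hq2 hj, hpm]
        exact gPtNonneg_spec L hna (by rw [← hpm]; exact hs) (Nat.mod_lt _ hL0))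
      le_rfl
    exact_mod_cast hz
  · simpa [rowR] using hlow
  · simpa [rowR] using hupp

omit [NeZero L] in
/-- `cos(2πp₁/L)` from the table. [folklore] -/
theorem mem_cos_nat (hL : 3 ≤ L) {p1 : ℕ} (hp1 : p1 < L) :
    mem (Real.cos (2 * Real.pi * p1 / L)) (getIv (cosTab L) (p1 % L)) := by
  rw [Nat.mod_eq_of_lt hp1, getIv_cosTab hp1]
  exact mem_cosIv hL hp1

omit [NeZero L] in
/-- `sin(2πp₁/L)` from the table at modulus `4L`. [folklore] -/
theorem mem_sin_nat (hL : 3 ≤ L) {p1 : ℕ} (hp1 : p1 < L) :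
    mem (Real.sin (2 * Real.pi * p1 / L)) (getIv (cosTab (4 * L)) ((4 * (p1 % L) + 3 * L) % (4 * L))) := by
  have hL0 : 0 < L := by omega
  have h4L : 3 ≤ 4 * L := by omega
  have h4L0 : 0 < 4 * L := by omega
  rw [Nat.mod_eq_of_lt hp1, sin_eq_cos_shift L hL0, cos_mod (4 * L) h4L0]
  have hidx : (4 * p1 + 3 * L) % (4 * L) < 4 * L := Nat.mod_lt _ h4L0
  rw [getIv_cosTab hidx]
  exact mem_cosIv h4L hidx

/-- ★ the signed accumulation encloses `(D³·Re W, D³·Im W)` at the point `λ₀·D = la`. [folklore] -/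
theorem sumW_mem (hL : 3 ≤ L) (hla : (la : ℝ) ≤ lam * ((D : ℤ) : ℝ)) (hlb : lam * ((D : ℤ) : ℝ) ≤ (la : ℝ))
    (hpos : denCellPos L (cosTab L) la la = true) (hna : gPtNonneg L la = true)
    {q1 q2 : ℕ} (hq2 : q2 < L) :
    ∀ n : ℕ, n ≤ L →
      let w := sumWRow L (gPt L la) (cosTab L) (cosTab (4 * L)) q1 q2 n
      let D3 : ℝ := ((D : ℤ) : ℝ) * ((D : ℤ) : ℝ) * ((D : ℤ) : ℝ)
      ((w.1.1 : ℤ) : ℝ) ≤ (∑ p1 ∈ range n, Real.cos (2 * Real.pi * p1 / L) * rowR L lam q1 q2 p1) * D3 ∧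
      (∑ p1 ∈ range n, Real.cos (2 * Real.pi * p1 / L) * rowR L lam q1 q2 p1) * D3 ≤ ((w.1.2 : ℤ) : ℝ) ∧
      ((w.2.1 : ℤ) : ℝ) ≤ (∑ p1 ∈ range n, Real.sin (2 * Real.pi * p1 / L) * rowR L lam q1 q2 p1) * D3 ∧
      (∑ p1 ∈ range n, Real.sin (2 * Real.pi * p1 / L) * rowR L lam q1 q2 p1) * D3 ≤ ((w.2.2 : ℤ) : ℝ) := by
  intro n
  induction n with
  | zero => intro _; simp [sumWRow]
  | succ n ih =>
    intro hn
    have hn' : n < L := hn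
    obtain ⟨i1, i2, i3, i4⟩ := ih (by omega)
    obtain ⟨hd0, hd1, hd2⟩ := rowR_mem hL hla hlb hpos hna hq2 hn'
    have hc := smulNN_sound (mem_cos_nat hL hn') hd0 hd1 hd2
    have hs := smulNN_sound (mem_sin_nat hL hn') hd0 hd1 hd2
    simp only [sumWRow, Finset.sum_range_succ]
    push_cast
    refine ⟨?_, ?_, ?_, ?_⟩ <;> nlinarith [hc.1, hc.2, hs.1, hs.2, i1, i2, i3, i4]

end cell

end FinXD

end Summit.HubbardSuperconductivity.HubbardSuperconductivity.Theorems.AnisotropyChord.Transfer.Fibre3
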